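import Summits.AtomisticToContinuum.FouriersLaw.Theses.OddSectorIrreversibility
import Mathlib

/-!
# Kernel check of the glue of idea `two-scale-gluing-log-rigidity` (crux stmt-AtomisticToContinuum-9141)

`logScaleRigidity_of_dense : LogTwoLogThreeDense → LogScaleRigidity` — the restricted-Fekete lemma of the card,
proved modulo the elementary Kronecker-density fact (isolated as a hypothesis so that the limsup/liminf
bookkeeping, where an error could hide, is what gets checked).
-/

open Filter Topology Finset

namespace TwoScaleGluingGlue

/-- Same statement as `Sketch.lean`'s `LogScaleRigidity`. -/
def LogScaleRigidity : Prop :=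
  ∀ (d : ℕ → ℝ) (S C c : ℝ) (ε : ℕ → ℝ) (N₀ : ℕ), 0 < c →
    (∀ N : ℕ, N₀ ≤ N → c ≤ d N) → (∀ N : ℕ, d N ≤ S) →
    (∀ N : ℕ, N₀ ≤ N → d N - d (N + 1) ≤ C / N) →
    Antitone ε → Summable (fun k : ℕ => ε (2 ^ k)) →
    (∀ N : ℕ, N₀ ≤ N → d N - ε N ≤ d (2 * N)) →
    (∀ N : ℕ, N₀ ≤ N → d N - ε N ≤ d (3 * N)) →
    ∃ k : ℝ, 0 < k ∧ Tendsto d atTop (𝓝 k)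

/-- Same statement as `Sketch.lean`'s `LogTwoLogThreeDense`. -/
def LogTwoLogThreeDense : Prop :=
  ∀ δ : ℝ, 0 < δ → ∃ X₀ : ℝ, ∀ X : ℝ, X₀ ≤ X →
    ∃ a b : ℕ, X - δ ≤ a * Real.log 2 + b * Real.log 3 ∧ a * Real.log 2 + b * Real.log 3 ≤ X

/-! ### L0: the slack is nonnegative -/

theorem eps_nonneg {ε : ℕ → ℝ} (hε : Antitone ε) (hsum : Summable (fun k : ℕ => ε (2 ^ k))) (n : ℕ) :
    0 ≤ ε n := by
  have h0 : Tendsto (fun k : ℕ => ε (2 ^ k)) atTop (𝓝 0) := hsum.tendsto_atTop_zero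
  refine le_of_tendsto h0 ?_
  refine eventually_atTop.2 ⟨n, fun k hk => hε ?_⟩
  calc n ≤ 2 ^ n := (Nat.lt_two_pow_self).le
    _ ≤ 2 ^ k := Nat.pow_le_pow_right (by norm_num) hk

/-! ### L1: slow decrease, summed -/

theorem slow_sum {d : ℕ → ℝ} {C : ℝ} {N₀ : ℕ} (hC : 0 ≤ C)
    (hslow : ∀ N : ℕ, N₀ ≤ N → d N - d (N + 1) ≤ C / N) {N : ℕ} (hN0 : N₀ ≤ N) (hN2 : 2 ≤ N) :
    ∀ M : ℕ, N ≤ M → d N - d M ≤ C * (Real.log ((M : ℝ) - 1) - Real.log ((N : ℝ) - 1)) := by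
  refine Nat.le_induction ?_ ?_
  · simp
  · intro M hNM ih
    have hM2 : (2 : ℝ) ≤ M := by exact_mod_cast hN2.trans hNM
    have hMpos : (0 : ℝ) < M := by linarith
    have hM1pos : (0 : ℝ) < (M : ℝ) - 1 := by linarith
    have hstep : d M - d (M + 1) ≤ C / M := hslow M (hN0.trans hNM)
    -- 1/M ≤ log M - log (M - 1)
    have hlog : Real.log (((M : ℝ) - 1) / M) ≤ ((M : ℝ) - 1) / M - 1 :=
      Real.log_le_sub_one_of_pos (div_pos hM1pos hMpos)
    have hdiv : Real.log (((M : ℝ) - 1) / M) = Real.log ((M : ℝ) - 1) - Real.log M :=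
      Real.log_div hM1pos.ne' hMpos.ne'
    have hinv : ((M : ℝ) - 1) / M - 1 = -(1 / M) := by field_simp; ring
    have hkey : C / M ≤ C * (Real.log (M : ℝ) - Real.log ((M : ℝ) - 1)) := by
      have : 1 / (M : ℝ) ≤ Real.log (M : ℝ) - Real.log ((M : ℝ) - 1) := by linarith
      calc C / M = C * (1 / M) := by ring
        _ ≤ C * (Real.log (M : ℝ) - Real.log ((M : ℝ) - 1)) := mul_le_mul_of_nonneg_left this hC
    have hcast : (((M + 1 : ℕ) : ℝ) - 1) = (M : ℝ) := by push_cast; ring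
    rw [hcast]
    calc d N - d (M + 1) = (d N - d M) + (d M - d (M + 1)) := by ring
      _ ≤ C * (Real.log ((M : ℝ) - 1) - Real.log ((N : ℝ) - 1)) + C / M := add_le_add ih hstep
      _ ≤ C * (Real.log ((M : ℝ) - 1) - Real.log ((N : ℝ) - 1))
          + C * (Real.log (M : ℝ) - Real.log ((M : ℝ) - 1)) := by linarith
      _ = C * (Real.log (M : ℝ) - Real.log ((N : ℝ) - 1)) := by ring

/-! ### L2: staircases -/

theorem stair2 {d ε : ℕ → ℝ} {N₀ : ℕ} (h2 : ∀ N : ℕ, N₀ ≤ N → d N - ε N ≤ d (2 * N)) {N : ℕ}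
    (hN : N₀ ≤ N) : ∀ a : ℕ, d N - ∑ i ∈ range a, ε (2 ^ i * N) ≤ d (2 ^ a * N) := by
  intro a
  induction a with
  | zero => simp
  | succ a ih =>
    have hle : N₀ ≤ 2 ^ a * N := hN.trans (Nat.le_mul_of_pos_left N (Nat.pos_of_ne_zero (by positivity)))
    have := h2 (2 ^ a * N) hle
    rw [sum_range_succ, pow_succ]
    have hmul : 2 ^ a * 2 * N = 2 * (2 ^ a * N) := by ring
    rw [hmul]
    linarith

theorem stair3 {d ε : ℕ → ℝ} {N₀ : ℕ} (h3 : ∀ N : ℕ, N₀ ≤ N → d N - ε N ≤ d (3 * N)) {P : ℕ}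
    (hP : N₀ ≤ P) : ∀ b : ℕ, d P - ∑ j ∈ range b, ε (3 ^ j * P) ≤ d (3 ^ b * P) := by
  intro b
  induction b with
  | zero => simp
  | succ b ih =>
    have hle : N₀ ≤ 3 ^ b * P := hP.trans (Nat.le_mul_of_pos_left P (Nat.pos_of_ne_zero (by positivity)))
    have := h3 (3 ^ b * P) hle
    rw [sum_range_succ, pow_succ]
    have hmul : 3 ^ b * 3 * P = 3 * (3 ^ b * P) := by ring
    rw [hmul]
    linarith

/-- Bounding a staircase sum by a dyadic tail: if every argument of the sum is `≥ 2^(i+L)` termwise,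
antitonicity moves the sum below the tail `∑' k, ε (2^(k+L))`. Shifted version (offset `a`). -/
theorem sum_le_tail {ε : ℕ → ℝ} (hε : Antitone ε) (hsum : Summable (fun k : ℕ => ε (2 ^ k)))
    (L a n : ℕ) (g : ℕ → ℕ) (hg : ∀ j, j < n → 2 ^ (j + a + L) ≤ g j) :
    ∑ j ∈ range n, ε (g j) ≤ ∑' k, ε (2 ^ (k + L)) := by
  have hnn : ∀ m, 0 ≤ ε m := eps_nonneg hε hsum
  have hsumL : Summable (fun k : ℕ => ε (2 ^ (k + L))) := by
    have := (summable_nat_add_iff (f := fun k : ℕ => ε (2 ^ k)) L).2 hsum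
    simpa using this
  -- termwise bound, then the finite sum over the image {a, …, a+n-1}
  calc ∑ j ∈ range n, ε (g j) ≤ ∑ j ∈ range n, ε (2 ^ ((j + a) + L)) := by
        refine sum_le_sum fun j hj => hε ?_
        have := hg j (mem_range.1 hj)
        simpa [add_assoc] using this
    _ = ∑ k ∈ (range n).image (fun j => j + a), ε (2 ^ (k + L)) := by
        rw [sum_image]
        intro x _ y _ hxy
        simpa using hxy
    _ ≤ ∑' k, ε (2 ^ (k + L)) := by
        exact hsumL.sum_le_tsum _ (fun k _ => hnn _)

/-! ### The glue -/

theorem logScaleRigidity_of_dense (hD : LogTwoLogThreeDense) : LogScaleRigidity := by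
  intro d S C c ε N₀ hc hlow hbdd hslow hε hsum h2 h3
  -- nonnegative Lipschitz constant
  set C' : ℝ := max C 0 with hC'def
  have hC' : 0 ≤ C' := le_max_right _ _
  have hslow' : ∀ N : ℕ, N₀ ≤ N → d N - d (N + 1) ≤ C' / N := fun N hN =>
    (hslow N hN).trans (div_le_div_of_nonneg_right (le_max_left _ _) (Nat.cast_nonneg N))
  have hnn : ∀ m, 0 ≤ ε m := eps_nonneg hε hsum
  -- dyadic tails
  set T : ℕ → ℝ := fun L => ∑' k, ε (2 ^ (k + L)) with hTdef
  have hT0 : Tendsto T atTop (𝓝 0) := by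
    have := tendsto_sum_nat_add (fun k : ℕ => ε (2 ^ k))
    simpa [hTdef] using this
  -- the Cauchy criterion
  have key : ∀ η : ℝ, 0 < η → ∃ K : ℕ, ∃ B : ℝ, ∀ M : ℕ, K ≤ M → B - 5 * η ≤ d M ∧ d M ≤ B := by
    intro η hη
    -- δ with C' δ ≤ η
    set δ : ℝ := η / (C' + 1) with hδdef
    have hδ : 0 < δ := div_pos hη (by linarith)
    have hC'δ : C' * δ ≤ η := by
      rw [hδdef]
      rw [mul_div_assoc']
      rw [div_le_iff₀ (by linarith)]
      nlinarith
    obtain ⟨X₀, hX₀⟩ := hD δ hδ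
    -- L with T L ≤ η
    obtain ⟨L, hL⟩ : ∃ L : ℕ, ∀ L', L ≤ L' → T L' ≤ η := by
      have := (hT0.eventually (ge_mem_nhds hη))
      obtain ⟨L, hL⟩ := eventually_atTop.1 this
      exact ⟨L, hL⟩
    have hTL : T L ≤ η := hL L le_rfl
    -- threshold N₁
    set N₁ : ℕ := max (max N₀ 2) (max (2 ^ L) (⌈1 / δ⌉₊ + 2)) with hN₁def
    have hN₁0 : N₀ ≤ N₁ := (le_max_left _ _).trans (le_max_left _ _)
    have hN₁2 : 2 ≤ N₁ := (le_max_right _ _).trans (le_max_left _ _)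
    have hN₁L : 2 ^ L ≤ N₁ := (le_max_left _ _).trans (le_max_right _ _)
    have hN₁δ : ⌈1 / δ⌉₊ + 2 ≤ N₁ := (le_max_right _ _).trans (le_max_right _ _)
    have hinvδ : ∀ n : ℕ, N₁ ≤ n → 1 / ((n : ℝ) - 1) ≤ δ := by
      intro n hn
      have h1 : (1 / δ : ℝ) ≤ ⌈1 / δ⌉₊ := Nat.le_ceil _
      have h2' : ((⌈1 / δ⌉₊ + 2 : ℕ) : ℝ) ≤ n := by exact_mod_cast hN₁δ.trans hn
      push_cast at h2'
      have hpos : 0 < (n : ℝ) - 1 := by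
        have : (0:ℝ) ≤ ⌈1 / δ⌉₊ := Nat.cast_nonneg _
        linarith
      rw [div_le_iff₀ hpos]
      have : 1 / δ ≤ (n : ℝ) - 1 := by linarith
      calc (1 : ℝ) = (1 / δ) * δ := by field_simp
        _ ≤ ((n : ℝ) - 1) * δ := mul_le_mul_of_nonneg_right this hδ.le
        _ = δ * ((n : ℝ) - 1) := by ring
    -- supremum of the tail beyond N₁
    set s : Set ℝ := Set.range (fun n : ℕ => d (n + N₁)) with hsdef
    have hs_bdd : BddAbove s := ⟨S, by rintro _ ⟨n, rfl⟩; exact hbdd _⟩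
    have hs_ne : s.Nonempty := ⟨d (0 + N₁), ⟨0, rfl⟩⟩
    set B : ℝ := sSup s with hBdef
    have hleB : ∀ M : ℕ, N₁ ≤ M → d M ≤ B := by
      intro M hM
      refine le_csSup hs_bdd ⟨M - N₁, ?_⟩
      simp [Nat.sub_add_cancel hM]
    obtain ⟨_, ⟨nstar, rfl⟩, hnstar⟩ := exists_lt_of_lt_csSup hs_ne (show B - η < B by linarith)
    set Nstar : ℕ := nstar + N₁ with hNstardef
    have hNstar₁ : N₁ ≤ Nstar := Nat.le_add_left _ _
    have hNstar0 : N₀ ≤ Nstar := hN₁0.trans hNstar₁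
    have hNstar2 : (2 : ℝ) ≤ Nstar := by exact_mod_cast hN₁2.trans hNstar₁
    have hNstarpos : (0 : ℝ) < Nstar := by linarith
    have hdNstar : B - η < d Nstar := hnstar
    -- the threshold K
    set X₀' : ℝ := max X₀ 0 with hX₀'def
    set K : ℕ := ⌈(Nstar : ℝ) * Real.exp X₀'⌉₊ + N₁ with hKdef
    refine ⟨K, B, fun M hM => ⟨?_, hleB M ((Nat.le_add_left _ _).trans hM)⟩⟩
    -- M is large: M ≥ Nstar * exp X₀'
    have hMreal : (Nstar : ℝ) * Real.exp X₀' ≤ M := by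
      have h1 : (Nstar : ℝ) * Real.exp X₀' ≤ ⌈(Nstar : ℝ) * Real.exp X₀'⌉₊ := Nat.le_ceil _
      have h2' : ((⌈(Nstar : ℝ) * Real.exp X₀'⌉₊ + N₁ : ℕ) : ℝ) ≤ M := by exact_mod_cast hM
      push_cast at h2'
      have : (0 : ℝ) ≤ N₁ := Nat.cast_nonneg _
      linarith
    have hMpos : (0 : ℝ) < M := lt_of_lt_of_le (by positivity) hMreal
    -- X := log (M / Nstar) ≥ X₀
    set X : ℝ := Real.log ((M : ℝ) / Nstar) with hXdef
    have hX : X₀ ≤ X := by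
      have hx1 : Real.exp X₀' ≤ (M : ℝ) / Nstar := by
        rw [le_div_iff₀ hNstarpos]; linarith
      have : X₀' ≤ X := by
        rw [hXdef, ← Real.log_exp X₀']
        exact Real.log_le_log (Real.exp_pos _) hx1
      exact (le_max_left _ _).trans this
    obtain ⟨a, b, hab1, hab2⟩ := hX₀ X hX
    -- P := 2^a 3^b and its real size
    set P : ℕ := 2 ^ a * 3 ^ b with hPdef
    have hPreal : (P : ℝ) = Real.exp (a * Real.log 2 + b * Real.log 3) := by
      rw [Real.exp_add, Real.exp_nat_mul, Real.exp_nat_mul, Real.exp_log (by norm_num),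
        Real.exp_log (by norm_num)]
      push_cast [hPdef]
      ring
    have hPpos : (0 : ℝ) < P := by rw [hPreal]; exact Real.exp_pos _
    have hexpX : Real.exp X = (M : ℝ) / Nstar := by
      rw [hXdef, Real.exp_log (div_pos hMpos hNstarpos)]
    -- P * Nstar ≤ M
    have hPN_le_M_real : (P : ℝ) * Nstar ≤ M := by
      have : (P : ℝ) ≤ (M : ℝ) / Nstar := by
        rw [hPreal, ← hexpX]; exact Real.exp_le_exp.2 hab2
      rwa [le_div_iff₀ hNstarpos] at this
    have hPN_le_M : P * Nstar ≤ M := by exact_mod_cast hPN_le_M_real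
    -- M ≤ exp δ * P * Nstar
    have hM_le : (M : ℝ) ≤ Real.exp δ * P * Nstar := by
      have : (M : ℝ) / Nstar ≤ Real.exp δ * P := by
        rw [← hexpX, hPreal, ← Real.exp_add]
        exact Real.exp_le_exp.2 (by linarith)
      rw [div_le_iff₀ hNstarpos] at this
      linarith
    -- staircase: d (P * Nstar) ≥ d Nstar - 2 T L
    have hNstarL : 2 ^ L ≤ Nstar := hN₁L.trans hNstar₁
    have hst2 : d Nstar - ∑ i ∈ range a, ε (2 ^ i * Nstar) ≤ d (2 ^ a * Nstar) := stair2 h2 hNstar0 a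
    have hP0 : N₀ ≤ 2 ^ a * Nstar :=
      hNstar0.trans (Nat.le_mul_of_pos_left _ (Nat.pos_of_ne_zero (by positivity)))
    have hst3 : d (2 ^ a * Nstar) - ∑ j ∈ range b, ε (3 ^ j * (2 ^ a * Nstar)) ≤ d (3 ^ b * (2 ^ a * Nstar)) :=
      stair3 h3 hP0 b
    have hsum2 : ∑ i ∈ range a, ε (2 ^ i * Nstar) ≤ T L := by
      refine sum_le_tail hε hsum L 0 a (fun i => 2 ^ i * Nstar) (fun i _ => ?_)
      calc 2 ^ (i + 0 + L) = 2 ^ i * 2 ^ L := by rw [add_zero, pow_add]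
        _ ≤ 2 ^ i * Nstar := Nat.mul_le_mul_left _ hNstarL
    have hsum3 : ∑ j ∈ range b, ε (3 ^ j * (2 ^ a * Nstar)) ≤ T L := by
      refine sum_le_tail hε hsum L a b (fun j => 3 ^ j * (2 ^ a * Nstar)) (fun j _ => ?_)
      calc 2 ^ (j + a + L) = 2 ^ j * (2 ^ a * 2 ^ L) := by rw [pow_add, pow_add, mul_assoc]
        _ ≤ 3 ^ j * (2 ^ a * Nstar) := by
          apply Nat.mul_le_mul (Nat.pow_le_pow_left (by norm_num) j) (Nat.mul_le_mul_left _ hNstarL)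
    have hPN_eq : P * Nstar = 3 ^ b * (2 ^ a * Nstar) := by rw [hPdef]; ring
    have hstair : d Nstar - 2 * T L ≤ d (P * Nstar) := by
      rw [hPN_eq]; linarith
    -- slow decrease from P * Nstar to M
    have hPN₁ : N₁ ≤ P * Nstar := by
      have h1P : 1 ≤ P := Nat.pos_of_ne_zero (by positivity)
      calc N₁ ≤ Nstar := hNstar₁
        _ = 1 * Nstar := (one_mul _).symm
        _ ≤ P * Nstar := Nat.mul_le_mul_right _ h1P
    have hPN0 : N₀ ≤ P * Nstar := hN₁0.trans hPN₁
    have hPN2 : 2 ≤ P * Nstar := hN₁2.trans hPN₁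
    have hslowsum := slow_sum hC' hslow' hPN0 hPN2 M hPN_le_M
    -- bound the log difference by δ + 1/(P Nstar - 1) ≤ 2δ
    have hPNreal2 : (2 : ℝ) ≤ (P * Nstar : ℕ) := by exact_mod_cast hPN2
    have hPNpos : (0 : ℝ) < (P * Nstar : ℕ) := by linarith
    have hPN1pos : (0 : ℝ) < ((P * Nstar : ℕ) : ℝ) - 1 := by linarith
    have hMreal2 : (2 : ℝ) ≤ M := hPNreal2.trans (by exact_mod_cast hPN_le_M)
    have hM1pos : (0 : ℝ) < (M : ℝ) - 1 := by linarith
    have hlog1 : Real.log ((M : ℝ) - 1) ≤ Real.log M := Real.log_le_log hM1pos (by linarith)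
    have hlog2 : Real.log (M : ℝ) - Real.log ((P * Nstar : ℕ) : ℝ) ≤ δ := by
      have hq : (M : ℝ) / ((P * Nstar : ℕ) : ℝ) ≤ Real.exp δ := by
        rw [div_le_iff₀ hPNpos]; push_cast; linarith
      have := Real.log_le_log (div_pos hMpos hPNpos) hq
      rwa [Real.log_exp, Real.log_div hMpos.ne' hPNpos.ne'] at this
    have hlog3 : Real.log ((P * Nstar : ℕ) : ℝ) - Real.log (((P * Nstar : ℕ) : ℝ) - 1) ≤ δ := by
      -- log(x/(x-1)) = -log((x-1)/x) ≤ -(1 - x/(x-1)) = 1/(x-1)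
      have hx := Real.one_sub_inv_le_log_of_pos (div_pos hPN1pos hPNpos)
      rw [Real.log_div hPN1pos.ne' hPNpos.ne'] at hx
      have hinv : 1 - ((((P * Nstar : ℕ) : ℝ) - 1) / ((P * Nstar : ℕ) : ℝ))⁻¹
          = -(1 / ((((P * Nstar : ℕ) : ℝ) - 1))) := by
        field_simp
        ring
      rw [hinv] at hx
      have := hinvδ (P * Nstar) hPN₁
      linarith
    have hslow_final : d (P * Nstar) - d M ≤ 2 * η := by
      have : Real.log ((M : ℝ) - 1) - Real.log (((P * Nstar : ℕ) : ℝ) - 1) ≤ 2 * δ := by linarith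
      calc d (P * Nstar) - d M ≤ C' * (Real.log ((M : ℝ) - 1) - Real.log (((P * Nstar : ℕ) : ℝ) - 1)) :=
            hslowsum
        _ ≤ C' * (2 * δ) := mul_le_mul_of_nonneg_left this hC'
        _ = 2 * (C' * δ) := by ring
        _ ≤ 2 * η := by linarith
    -- assemble
    linarith
  -- Cauchy ⇒ convergent
  have hcauchy : CauchySeq d := by
    refine Metric.cauchySeq_iff.2 fun e he => ?_
    obtain ⟨K, B, hK⟩ := key (e / 6) (by positivity)
    refine ⟨K, fun m hm n hn => ?_⟩
    obtain ⟨hm1, hm2⟩ := hK m hm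
    obtain ⟨hn1, hn2⟩ := hK n hn
    rw [Real.dist_eq, abs_sub_lt_iff]
    constructor <;> linarith
  obtain ⟨k, hk⟩ := cauchySeq_tendsto_of_complete hcauchy
  refine ⟨k, lt_of_lt_of_le hc ?_, hk⟩
  exact ge_of_tendsto hk (eventually_atTop.2 ⟨N₀, fun N hN => hlow N hN⟩)


/-! ### The Kronecker-density input, proved (so the glue is unconditional) -/

/-- Generic staircase covering: with a step `θ ∈ (0, δ]` and a coarse grid of mesh `α > 0`, every large `X`
is approximated from below within `δ` by `K α + m θ` with the side budget `p * m ≤ K`. -/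
theorem staircase (α θ δ : ℝ) (p : ℕ) (hα : 0 < α) (hθ : 0 < θ) (hθδ : θ ≤ δ) :
    ∃ X₀ : ℝ, ∀ X : ℝ, X₀ ≤ X → ∃ K m : ℕ, p * m ≤ K ∧ X - δ ≤ K * α + m * θ ∧ K * α + m * θ ≤ X := by
  refine ⟨(p * (α / θ + 1) + 1) * α, fun X hX => ?_⟩
  have hpos0 : 0 ≤ (p : ℝ) * (α / θ + 1) := by positivity
  have hX0 : 0 ≤ X := le_trans (by positivity) hX
  set K : ℕ := ⌊X / α⌋₊ with hKdef
  have hK1 : (K : ℝ) ≤ X / α := Nat.floor_le (div_nonneg hX0 hα.le)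
  have hK2 : X / α < K + 1 := Nat.lt_floor_add_one _
  set r : ℝ := X - K * α with hrdef
  have hr0 : 0 ≤ r := by
    have : (K : ℝ) * α ≤ X := by rwa [le_div_iff₀ hα] at hK1
    linarith
  have hrα : r < α := by
    have : X < (K + 1) * α := by rwa [div_lt_iff₀ hα] at hK2
    rw [hrdef]; linarith
  set m : ℕ := ⌊r / θ⌋₊ with hmdef
  have hm1 : (m : ℝ) ≤ r / θ := Nat.floor_le (div_nonneg hr0 hθ.le)
  have hm2 : r / θ < m + 1 := Nat.lt_floor_add_one _
  have hmθ : (m : ℝ) * θ ≤ r := by rwa [le_div_iff₀ hθ] at hm1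
  have hmθ2 : r < (m + 1) * θ := by rwa [div_lt_iff₀ hθ] at hm2
  refine ⟨K, m, ?_, ?_, ?_⟩
  · -- p m ≤ K, via reals
    have hmlt : (m : ℝ) < α / θ + 1 := by
      have : r / θ < α / θ := div_lt_div_of_pos_right hrα hθ
      linarith
    have hKge : (p : ℝ) * (α / θ + 1) ≤ K := by
      have h1 : (p * (α / θ + 1) + 1) * α ≤ X := hX
      have h2 : (p : ℝ) * (α / θ + 1) + 1 ≤ X / α := by rwa [le_div_iff₀ hα]
      linarith
    have : (p : ℝ) * m ≤ K := by
      calc (p : ℝ) * m ≤ p * (α / θ + 1) := mul_le_mul_of_nonneg_left hmlt.le (Nat.cast_nonneg p)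
        _ ≤ K := hKge
    exact_mod_cast this
  · rw [hrdef] at hmθ2; nlinarith
  · rw [hrdef] at hmθ; linarith

/-- `2^u ≠ 3^v` for `u, v ≥ 1` (parity), in the logarithmic form used below. -/
theorem log_two_three_independent {u v : ℕ} (hu : 1 ≤ u) (hv : 1 ≤ v) :
    (v : ℝ) * Real.log 3 - u * Real.log 2 ≠ 0 := by
  intro h
  have h1 : (v : ℝ) * Real.log 3 = u * Real.log 2 := by linarith
  have h2 : Real.exp ((v : ℝ) * Real.log 3) = Real.exp (u * Real.log 2) := by rw [h1]
  rw [Real.exp_nat_mul, Real.exp_nat_mul, Real.exp_log (by norm_num), Real.exp_log (by norm_num)] at h2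
  have h3 : (3 : ℕ) ^ v = 2 ^ u := by exact_mod_cast h2
  have hodd : Odd ((3 : ℕ) ^ v) := Odd.pow (by decide)
  have heven : Even ((2 : ℕ) ^ u) := (Nat.even_pow' (by omega)).2 (by decide)
  rw [h3] at hodd
  exact (Nat.not_even_iff_odd.2 hodd) heven

theorem logTwoLogThreeDense : LogTwoLogThreeDense := by
  intro δ hδ
  have hl2 : 0 < Real.log 2 := Real.log_pos (by norm_num)
  have hl3 : Real.log 2 < Real.log 3 := Real.log_lt_log (by norm_num) (by norm_num)
  set ξ : ℝ := Real.log 3 / Real.log 2 with hξdef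
  have hξ1 : 1 < ξ := by rw [hξdef, one_lt_div hl2]; exact hl3
  -- Dirichlet: |k ξ - j| ≤ 1/(n+1) with log 2 / (n+1) < δ
  set n : ℕ := ⌈Real.log 2 / δ⌉₊ + 1 with hndef
  have hnpos : 0 < n := Nat.succ_pos _
  have hnδ : Real.log 2 / ((n : ℝ) + 1) < δ := by
    have h1 : Real.log 2 / δ ≤ ⌈Real.log 2 / δ⌉₊ := Nat.le_ceil _
    have h2' : (n : ℝ) = ⌈Real.log 2 / δ⌉₊ + 1 := by rw [hndef]; push_cast; ring
    rw [div_lt_iff₀ (by positivity)]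
    have : Real.log 2 / δ < (n : ℝ) + 1 := by rw [h2']; linarith
    rw [div_lt_iff₀ hδ] at this
    linarith
  obtain ⟨j, k, hk0, _hkn, habs⟩ := Real.exists_int_int_abs_mul_sub_le ξ hnpos
  -- j ≥ 1
  have hn1 : (1 : ℝ) ≤ n := by exact_mod_cast hnpos
  have habs' : |(k : ℝ) * ξ - j| ≤ 1 / 2 := by
    refine habs.trans ?_
    rw [div_le_div_iff₀ (by positivity) (by norm_num)]
    linarith
  have hkξ : ξ ≤ (k : ℝ) * ξ := by
    have : (1 : ℝ) ≤ k := by exact_mod_cast hk0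
    nlinarith
  have hj0 : (0 : ℤ) < j := by
    have : (1 / 2 : ℝ) < j := by
      have := (abs_sub_le_iff.1 habs').1
      linarith
    exact_mod_cast (show (0 : ℝ) < j by linarith)
  obtain ⟨k', hk'⟩ := Int.eq_ofNat_of_zero_le hk0.le
  obtain ⟨j', hj'⟩ := Int.eq_ofNat_of_zero_le hj0.le
  have hk'1 : 1 ≤ k' := by omega
  have hj'1 : 1 ≤ j' := by omega
  -- θ₀ := k log 3 - j log 2 = log 2 · (k ξ - j)
  set θ₀ : ℝ := (k' : ℝ) * Real.log 3 - j' * Real.log 2 with hθ₀def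
  have hθ₀eq : θ₀ = Real.log 2 * ((k : ℝ) * ξ - j) := by
    rw [hθ₀def, hk', hj', hξdef]; push_cast
    field_simp
  have hθ₀abs : |θ₀| < δ := by
    rw [hθ₀eq, abs_mul, abs_of_pos hl2]
    calc Real.log 2 * |(k : ℝ) * ξ - j| ≤ Real.log 2 * (1 / ((n : ℝ) + 1)) :=
          mul_le_mul_of_nonneg_left habs hl2.le
      _ = Real.log 2 / ((n : ℝ) + 1) := by ring
      _ < δ := hnδ
  have hθ₀ne : θ₀ ≠ 0 := log_two_three_independent hj'1 hk'1
  rcases lt_or_gt_of_ne hθ₀ne with hneg | hpos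
  · -- θ := -θ₀ = j' log 2 - k' log 3 > 0; grid α = log 3, budget p = k'
    have hθ : 0 < -θ₀ := by linarith
    have hθδ : -θ₀ ≤ δ := by have := (abs_lt.1 hθ₀abs).1; linarith
    obtain ⟨X₀, hX₀⟩ := staircase (Real.log 3) (-θ₀) δ k' (by linarith) hθ hθδ
    refine ⟨X₀, fun X hX => ?_⟩
    obtain ⟨K, m, hpm, h1, h2⟩ := hX₀ X hX
    refine ⟨m * j', K - k' * m, ?_, ?_⟩ <;>
    · have hcast : ((K - k' * m : ℕ) : ℝ) = K - k' * m := by push_cast [Nat.cast_sub hpm]; ring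
      have hid : ((m * j' : ℕ) : ℝ) * Real.log 2 + ((K - k' * m : ℕ) : ℝ) * Real.log 3
          = K * Real.log 3 + m * (-θ₀) := by
        rw [hcast, hθ₀def]; push_cast; ring
      rw [hid]; assumption
  · -- θ := θ₀ > 0; grid α = log 2, budget p = j'
    have hθδ : θ₀ ≤ δ := (abs_lt.1 hθ₀abs).2.le
    obtain ⟨X₀, hX₀⟩ := staircase (Real.log 2) θ₀ δ j' hl2 hpos hθδ
    refine ⟨X₀, fun X hX => ?_⟩
    obtain ⟨K, m, hpm, h1, h2⟩ := hX₀ X hX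
    refine ⟨K - j' * m, m * k', ?_, ?_⟩ <;>
    · have hcast : ((K - j' * m : ℕ) : ℝ) = K - j' * m := by push_cast [Nat.cast_sub hpm]; ring
      have hid : ((K - j' * m : ℕ) : ℝ) * Real.log 2 + ((m * k' : ℕ) : ℝ) * Real.log 3
          = K * Real.log 2 + m * θ₀ := by
        rw [hcast, hθ₀def]; push_cast; ring
      rw [hid]; assumption

/-- **The glue of the card, unconditionally.** -/
theorem logScaleRigidity : LogScaleRigidity :=
  logScaleRigidity_of_dense logTwoLogThreeDense

end TwoScaleGluingGlue


/-!
# Sketch — crux-ideate `stmt-AtomisticToContinuum-9141` (`BoundedResponseConverges`), round 1, ideator 1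

Idea `two-scale-gluing-log-rigidity`: under the crux's own boundedness hypothesis, convergence of the
finite-size conductivity `D_N` to a positive limit follows from
* (U)   `UpperIncrement`      — one more bead raises the bath-to-bath resistance `R_N = (N-1)/D_N` by at most `C'`;
* (S23) `SelfSimilarGluing`   — ONE-SIDED, SUB-EXTENSIVE subadditivity at the two self-similar junctions only:
                                `R_{2N} ≤ 2 R_N + N ε(N)`, `R_{3N} ≤ 3 R_N + N ε(N)` with `ε ↓ 0`, `Σ_k ε(2^k) < ∞`;
* the pure real-analysis glue `LogScaleRigidity` (a restricted Fekete lemma: slowly decreasing in `log N`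
  + almost nondecreasing under `×2` and `×3` ⇒ convergent, by Kronecker density of `ℕ log 2 + ℕ log 3`).
Nothing here is proved; every declaration is a `Prop` (statement shapes that elaborate). The composition
`CompositionClaim` is what a crux-plan skeleton would prove sorry-free.
-/

namespace Summit.AtomisticToContinuum.FouriersLaw.Cruxes.BoundedResponseConverges.TwoScaleGluing

open Filter Topology
open Literature.MathematicalPhysics.KineticTheory.HeatConduction

/-- FIRST LEMMA (pure real analysis; the glue of the line). A sequence `d` which is eventually bounded
below by `c > 0`, bounded above by `S`, SLOWLY DECREASING in log scale (`d N - d (N+1) ≤ C/N`) and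
ALMOST NONDECREASING UNDER DOUBLING AND TRIPLING with an antitone slack `ε` that is summable along
`2^k` (a Dini condition in `log N`), converges to a positive limit. Proof sketch (paper, NOTES.md):
`limsup = liminf` via density of `{a log 2 + b log 3 : a b : ℕ}` at infinity + the log-Lipschitz lower
modulus; no subadditivity for general splits is used (contrast Fekete / de Bruijn–Erdős). -/
def LogScaleRigidity : Prop :=
  ∀ (d : ℕ → ℝ) (S C c : ℝ) (ε : ℕ → ℝ) (N₀ : ℕ), 0 < c →
    (∀ N : ℕ, N₀ ≤ N → c ≤ d N) → (∀ N : ℕ, d N ≤ S) →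
    (∀ N : ℕ, N₀ ≤ N → d N - d (N + 1) ≤ C / N) →
    Antitone ε → Summable (fun k : ℕ => ε (2 ^ k)) →
    (∀ N : ℕ, N₀ ≤ N → d N - ε N ≤ d (2 * N)) →
    (∀ N : ℕ, N₀ ≤ N → d N - ε N ≤ d (3 * N)) →
    ∃ k : ℝ, 0 < k ∧ Tendsto d atTop (𝓝 k)

/-- The number-theoretic input of `LogScaleRigidity`: the additive semigroup generated by `log 2` and
`log 3` is eventually `δ`-dense for every `δ > 0` (irrationality of `log 3 / log 2`, i.e. `2^p ≠ 3^q`,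
plus Dirichlet's pigeonhole), with approximation FROM BELOW. -/
def LogTwoLogThreeDense : Prop :=
  ∀ δ : ℝ, 0 < δ → ∃ X₀ : ℝ, ∀ X : ℝ, X₀ ≤ X →
    ∃ a b : ℕ, X - δ ≤ a * Real.log 2 + b * Real.log 3 ∧ a * Real.log 2 + b * Real.log 3 ≤ X

/-- The crux's common prefix (parameters `> 0`, weak-NESS uniqueness, a steady-state family, `T > 0`,
response coefficients `D` of clause (ii)), abstracted over a property `Φ` of the response sequence.
Constants inside `Φ` may depend on everything quantified before. Verbatim the binders of
`Theses.OddSectorIrreversibility.BoundedResponseConverges` minus its last two hypotheses. -/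
def WithResponse (Φ : (ℕ → ℝ) → Prop) : Prop :=
  ∀ ω₂ lam β γ : ℝ, 0 < ω₂ → 0 < lam → 0 < β → 0 < γ →
    (∀ (N : ℕ) (T_L T_R : ℝ), 0 < T_L → 0 < T_R →
      ∀ μ ν : MeasureTheory.Measure (PhaseSpace N),
        (pinnedChain ω₂ lam β γ).IsSteadyState N T_L T_R μ →
        (pinnedChain ω₂ lam β γ).IsSteadyState N T_L T_R ν → μ = ν) →
    ∀ μ : (N : ℕ) → ℝ → ℝ → MeasureTheory.Measure (PhaseSpace N),
      (∀ (N : ℕ) (T_L T_R : ℝ), 0 < T_L → 0 < T_R →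
        (pinnedChain ω₂ lam β γ).IsSteadyState N T_L T_R (μ N T_L T_R)) →
      ∀ T : ℝ, 0 < T → ∀ D : ℕ → ℝ,
        (∀ N : ℕ, Tendsto (fun δ : ℝ =>
            (pinnedChain ω₂ lam β γ).totalCurrent (μ N (T + δ / 2) (T - δ / 2)) / δ)
          (𝓝[≠] 0) (𝓝 (D N))) →
        Φ D

/-- The bath-to-bath linear-response RESISTANCE of the `N`-chain read off a response sequence:
`R_N = (N-1)/D_N` (junk where `D_N = 0`; used only under `0 < D_N`). -/
noncomputable def resistance (D : ℕ → ℝ) (N : ℕ) : ℝ := ((N : ℝ) - 1) / D N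

/-- STUB SHAPE (U) `UpperIncrement` — "one more bead costs at most `C'`": eventually `D_N > 0` and
`R_{N+1} ≤ R_N + C'` (note `R_{N+1} = N / D_{N+1}`). One-sided and LOCAL (a single site at the contact);
under the crux's `D_N ≤ S` it yields the slowly-decreasing modulus `D_N - D_{N+1} ≤ C' S² / N` AND the
floor `liminf D_N ≥ 1/C'` (positivity of the limit comes from here, for free). -/
def UpperIncrement : Prop :=
  WithResponse fun D => ∃ C : ℝ, ∃ N₀ : ℕ, ∀ N : ℕ, N₀ ≤ N →
    0 < D N ∧ resistance D (N + 1) ≤ resistance D N + C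

/-- STUB SHAPE (S23) `SelfSimilarGluing` — ONE-SIDED subadditivity at the two SELF-SIMILAR junctions
only (`N ⊕ N` and `N ⊕ N ⊕ N`, both reflection-symmetric configurations), with SUB-EXTENSIVE slack:
`R_{2N} ≤ 2R_N + N ε(N)`, `R_{3N} ≤ 3R_N + N ε(N)`, `ε` antitone and summable along `2^k`
(e.g. `ε(N) = (log N)^{-1-α}` or `N^{-η}` — gluing with a mesoscopic repair window is allowed to lose
`o(N)` resistance). Under `D_N ≤ S` it yields `D_{2N} ≥ D_N - S² ε(N)`, `D_{3N} ≥ D_N - S² ε(N)/2`. -/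
def SelfSimilarGluing : Prop :=
  WithResponse fun D => ∃ ε : ℕ → ℝ, Antitone ε ∧ Summable (fun k : ℕ => ε (2 ^ k)) ∧
    ∃ N₀ : ℕ, ∀ N : ℕ, N₀ ≤ N →
      resistance D (2 * N) ≤ 2 * resistance D N + N * ε N ∧
      resistance D (3 * N) ≤ 3 * resistance D N + N * ε N

/-- What a crux-plan skeleton for this idea proves sorry-free (composition; arithmetic + `LogScaleRigidity`):
the three statements above imply the crux BY NAME. Stated here as a `Prop` only. -/
def CompositionClaim : Prop :=
  LogScaleRigidity → UpperIncrement → SelfSimilarGluing →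
    Summit.AtomisticToContinuum.FouriersLaw.Theses.OddSectorIrreversibility.BoundedResponseConverges

/-- Sanity: the crux decl is the one all four owner routes share (same normalised signature); the
TransferKernelPositivity / LocalOhmBV / MatthiessenLadder copies are closed by the same composition. -/
example : CompositionClaim = (LogScaleRigidity → UpperIncrement → SelfSimilarGluing →
    Summit.AtomisticToContinuum.FouriersLaw.Theses.OddSectorIrreversibility.BoundedResponseConverges) := rfl


/-! ## Composition (what crux-plan's `BoundedResponseConverges_of` will be): the two physics stubs imply the crux,
the glue being the PROVED `TwoScaleGluingGlue.logScaleRigidity`. Pure inequality bookkeeping. -/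

section Composition

open Literature.MathematicalPhysics.KineticTheory.HeatConduction

theorem boundedResponseConverges_of_glue (hglue : LogScaleRigidity) (hU : UpperIncrement)
    (hS : SelfSimilarGluing) :
    Summit.AtomisticToContinuum.FouriersLaw.Theses.OddSectorIrreversibility.BoundedResponseConverges := by
  intro ω₂ lam β γ hω hl hβ hγ hUniq μ hμ T hT D hD hBdd
  obtain ⟨C', N₁, hU'⟩ := hU ω₂ lam β γ hω hl hβ hγ hUniq μ hμ T hT D hD
  obtain ⟨ε, hεa, hεs, N₂, hS'⟩ := hS ω₂ lam β γ hω hl hβ hγ hUniq μ hμ T hT D hD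
  obtain ⟨S, hS0⟩ := hBdd
  have hDS : ∀ N, D N ≤ S := fun N => (le_abs_self _).trans (hS0 ⟨N, rfl⟩)
  have hεnn : ∀ n, 0 ≤ ε n := TwoScaleGluingGlue.eps_nonneg hεa hεs
  -- thresholds
  set N₀ : ℕ := max (max N₁ N₂) 2 with hN₀def
  have hN₀1 : N₁ ≤ N₀ := (le_max_left _ _).trans (le_max_left _ _)
  have hN₀2 : N₂ ≤ N₀ := (le_max_right _ _).trans (le_max_left _ _)
  have hN₀two : 2 ≤ N₀ := le_max_right _ _
  have hpos : ∀ N, N₀ ≤ N → 0 < D N := fun N hN => (hU' N (hN₀1.trans hN)).1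
  have hSpos : 0 < S := (hpos N₀ le_rfl).trans_le (hDS N₀)
  -- resistance bookkeeping
  have hRdef : ∀ N, resistance D N = ((N : ℝ) - 1) / D N := fun _ => rfl
  have hN1pos : ∀ N, N₀ ≤ N → (0 : ℝ) < (N : ℝ) - 1 := by
    intro N hN
    have : (2 : ℝ) ≤ N := by exact_mod_cast hN₀two.trans hN
    linarith
  have hRpos : ∀ N, N₀ ≤ N → 0 < resistance D N := fun N hN =>
    div_pos (hN1pos N hN) (hpos N hN)
  have hRlow : ∀ N, N₀ ≤ N → ((N : ℝ) - 1) / S ≤ resistance D N := fun N hN =>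
    div_le_div_of_nonneg_left (hN1pos N hN).le (hpos N hN) (hDS N)
  have hDeq : ∀ N, N₀ ≤ N → D N = ((N : ℝ) - 1) / resistance D N := by
    intro N hN
    have h1 := (hN1pos N hN).ne'
    have h2 := (hpos N hN).ne'
    rw [hRdef]
    field_simp
  have hinvR : ∀ N, N₀ ≤ N → 1 / resistance D N ≤ S / ((N : ℝ) - 1) := by
    intro N hN
    have h := hRlow N hN
    rw [div_le_div_iff₀ (hRpos N hN) (hN1pos N hN), one_mul]
    rw [div_le_iff₀ hSpos] at h
    linarith
  -- (1) linear upper bound on the resistance and the floor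
  set Cp : ℝ := max C' 0 with hCpdef
  have hCp : 0 ≤ Cp := le_max_right _ _
  have hstep : ∀ N, N₀ ≤ N → resistance D (N + 1) ≤ resistance D N + Cp := fun N hN =>
    (hU' N (hN₀1.trans hN)).2.trans (by simp [hCpdef])
  have hRup : ∀ N, N₀ ≤ N → resistance D N ≤ resistance D N₀ + Cp * ((N : ℝ) - N₀) := by
    refine Nat.le_induction ?_ ?_
    · simp
    · intro N hN ih
      calc resistance D (N + 1) ≤ resistance D N + Cp := hstep N hN
        _ ≤ resistance D N₀ + Cp * ((N : ℝ) - N₀) + Cp := by linarith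
        _ = resistance D N₀ + Cp * (((N + 1 : ℕ) : ℝ) - N₀) := by push_cast; ring
  set Cq : ℝ := max Cp (resistance D N₀) with hCqdef
  have hCqpos : 0 < Cq := (hRpos N₀ le_rfl).trans_le (le_max_right _ _)
  have hRlin : ∀ N, N₀ ≤ N → resistance D N ≤ Cq * N := by
    intro N hN
    have h1 : resistance D N₀ ≤ Cq := le_max_right _ _
    have h2 : Cp ≤ Cq := le_max_left _ _
    have hNN : ((N₀ : ℕ) : ℝ) ≤ N := by exact_mod_cast hN
    have hN₀one : (1 : ℝ) ≤ N₀ := by exact_mod_cast (le_trans (by norm_num) hN₀two)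
    have hsub : (0 : ℝ) ≤ (N : ℝ) - N₀ := by linarith
    calc resistance D N ≤ resistance D N₀ + Cp * ((N : ℝ) - N₀) := hRup N hN
      _ ≤ Cq + Cq * ((N : ℝ) - N₀) := add_le_add h1 (mul_le_mul_of_nonneg_right h2 hsub)
      _ = Cq * (1 + ((N : ℝ) - N₀)) := by ring
      _ ≤ Cq * N := mul_le_mul_of_nonneg_left (by linarith) hCqpos.le
  have hfloor : ∀ N, N₀ ≤ N → 1 / (2 * Cq) ≤ D N := by
    intro N hN
    have hNr : (2 : ℝ) ≤ N := by exact_mod_cast hN₀two.trans hN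
    have hNpos : (0 : ℝ) < N := by linarith
    rw [hDeq N hN]
    have h1 : ((N : ℝ) - 1) / (Cq * N) ≤ ((N : ℝ) - 1) / resistance D N :=
      div_le_div_of_nonneg_left (hN1pos N hN).le (hRpos N hN) (hRlin N hN)
    refine le_trans ?_ h1
    rw [div_le_div_iff₀ (by positivity) (by positivity)]
    nlinarith
  -- (2) slow decrease
  have hslowD : ∀ N, N₀ ≤ N → D N - D (N + 1) ≤ (2 * Cp * S ^ 2) / N := by
    intro N hN
    have hN' : N₀ ≤ N + 1 := hN.trans (Nat.le_succ _)
    have hNr : (2 : ℝ) ≤ N := by exact_mod_cast hN₀two.trans hN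
    set R := resistance D N with hR
    set R' := resistance D (N + 1) with hR'
    have hR0 : 0 < R := hRpos N hN
    have hR'0 : 0 < R' := hRpos (N + 1) hN'
    have hR'le : R' ≤ R + Cp := hstep N hN
    have hDN : D N = ((N : ℝ) - 1) / R := hDeq N hN
    have hDN' : D (N + 1) = (N : ℝ) / R' := by
      have := hDeq (N + 1) hN'
      simpa using this
    have hlow' : (N : ℝ) / (R + Cp) ≤ D (N + 1) := by
      rw [hDN']
      exact div_le_div_of_nonneg_left (by linarith) hR'0 hR'le
    have hmain : ((N : ℝ) - 1) / R - N / (R + Cp) ≤ Cp * S ^ 2 / ((N : ℝ) - 1) := by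
      have hRCp : 0 < R + Cp := by linarith
      have hcomb : ((N : ℝ) - 1) / R - N / (R + Cp) = (((N : ℝ) - 1) * Cp - R) / (R * (R + Cp)) := by
        field_simp
        ring
      rw [hcomb]
      have hnum : ((N : ℝ) - 1) * Cp - R ≤ ((N : ℝ) - 1) * Cp := by linarith
      have hnum0 : 0 ≤ ((N : ℝ) - 1) * Cp := by
        have := (hN1pos N hN).le
        positivity
      have hden : R * R ≤ R * (R + Cp) := by nlinarith
      have hden0 : 0 < R * R := by positivity
      calc (((N : ℝ) - 1) * Cp - R) / (R * (R + Cp)) ≤ (((N : ℝ) - 1) * Cp) / (R * R) :=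
            div_le_div₀ hnum0 hnum hden0 hden
        _ = ((N : ℝ) - 1) * Cp * (1 / R) ^ 2 := by
            field_simp
        _ ≤ ((N : ℝ) - 1) * Cp * (S / ((N : ℝ) - 1)) ^ 2 := by
            apply mul_le_mul_of_nonneg_left _ hnum0
            exact pow_le_pow_left₀ (by positivity) (hinvR N hN) 2
        _ = Cp * S ^ 2 / ((N : ℝ) - 1) := by
            field_simp
    have hfin : Cp * S ^ 2 / ((N : ℝ) - 1) ≤ 2 * Cp * S ^ 2 / N := by
      rw [div_le_div_iff₀ (hN1pos N hN) (by linarith)]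
      have : 0 ≤ Cp * S ^ 2 := by positivity
      nlinarith
    calc D N - D (N + 1) ≤ ((N : ℝ) - 1) / R - N / (R + Cp) := by rw [hDN]; linarith
      _ ≤ Cp * S ^ 2 / ((N : ℝ) - 1) := hmain
      _ ≤ 2 * Cp * S ^ 2 / N := hfin
  -- (3)/(4) doubling and tripling
  have hscale : ∀ (k : ℕ), (k = 2 ∨ k = 3) → ∀ N, N₀ ≤ N →
      resistance D (k * N) ≤ k * resistance D N + N * ε N → D N - S ^ 2 * ε N ≤ D (k * N) := by
    intro k hk N hN hglueR
    have hk2 : (2 : ℕ) ≤ k := by rcases hk with rfl | rfl <;> norm_num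
    have hk3 : k ≤ 3 := by rcases hk with rfl | rfl <;> norm_num
    have hkr2 : (2 : ℝ) ≤ k := by exact_mod_cast hk2
    have hkr3 : (k : ℝ) ≤ 3 := by exact_mod_cast hk3
    have hkN : N₀ ≤ k * N := hN.trans (Nat.le_mul_of_pos_left N (by omega))
    have hNr : (2 : ℝ) ≤ N := by exact_mod_cast hN₀two.trans hN
    set R := resistance D N with hR
    set Rk := resistance D (k * N) with hRk
    have hR0 : 0 < R := hRpos N hN
    have hRk0 : 0 < Rk := hRpos (k * N) hkN
    have hεN : 0 ≤ ε N := hεnn N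
    have hDN : D N = ((N : ℝ) - 1) / R := hDeq N hN
    have hDk : D (k * N) = ((k : ℝ) * N - 1) / Rk := by
      have := hDeq (k * N) hkN
      simpa using this
    have hden0 : 0 < (k : ℝ) * R + N * ε N := lt_of_lt_of_le hRk0 hglueR
    have hlow' : ((k : ℝ) * N - 1) / ((k : ℝ) * R + N * ε N) ≤ D (k * N) := by
      rw [hDk]
      refine div_le_div_of_nonneg_left ?_ hRk0 hglueR
      nlinarith
    have hmain : ((N : ℝ) - 1) / R - ((k : ℝ) * N - 1) / ((k : ℝ) * R + N * ε N) ≤ S ^ 2 * ε N := by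
      have hcomb : ((N : ℝ) - 1) / R - ((k : ℝ) * N - 1) / ((k : ℝ) * R + N * ε N)
          = (((N : ℝ) - 1) * N * ε N - (k - 1) * R) / (R * ((k : ℝ) * R + N * ε N)) := by
        field_simp
        ring
      rw [hcomb]
      have hnum : ((N : ℝ) - 1) * N * ε N - (k - 1) * R ≤ ((N : ℝ) - 1) * N * ε N := by nlinarith
      have hnum0 : 0 ≤ ((N : ℝ) - 1) * N * ε N := by
        have := (hN1pos N hN).le
        have : (0 : ℝ) ≤ N := by linarith
        positivity
      have hden : R * (2 * R) ≤ R * ((k : ℝ) * R + N * ε N) := by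
        apply mul_le_mul_of_nonneg_left _ hR0.le
        nlinarith
      have hden0 : 0 < R * (2 * R) := by positivity
      calc (((N : ℝ) - 1) * N * ε N - (k - 1) * R) / (R * ((k : ℝ) * R + N * ε N))
            ≤ (((N : ℝ) - 1) * N * ε N) / (R * (2 * R)) := div_le_div₀ hnum0 hnum hden0 hden
        _ = ((N : ℝ) - 1) * N * ε N / 2 * (1 / R) ^ 2 := by field_simp
        _ ≤ ((N : ℝ) - 1) * N * ε N / 2 * (S / ((N : ℝ) - 1)) ^ 2 := by
            apply mul_le_mul_of_nonneg_left _ (by positivity)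
            exact pow_le_pow_left₀ (by positivity) (hinvR N hN) 2
        _ = (N / (2 * ((N : ℝ) - 1))) * (S ^ 2 * ε N) := by
            field_simp
        _ ≤ 1 * (S ^ 2 * ε N) := by
            apply mul_le_mul_of_nonneg_right _ (by positivity)
            rw [div_le_one (by linarith [hN1pos N hN])]
            linarith
        _ = S ^ 2 * ε N := one_mul _
    calc D N - S ^ 2 * ε N ≤ ((k : ℝ) * N - 1) / ((k : ℝ) * R + N * ε N) := by rw [hDN]; linarith
      _ ≤ D (k * N) := hlow'
  have h2D : ∀ N, N₀ ≤ N → D N - S ^ 2 * ε N ≤ D (2 * N) := by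
    intro N hN
    refine hscale 2 (Or.inl rfl) N hN ?_
    have := (hS' N (hN₀2.trans hN)).1
    simpa using this
  have h3D : ∀ N, N₀ ≤ N → D N - S ^ 2 * ε N ≤ D (3 * N) := by
    intro N hN
    refine hscale 3 (Or.inr rfl) N hN ?_
    have := (hS' N (hN₀2.trans hN)).2
    simpa using this
  -- apply the glue
  have hεa' : Antitone (fun n : ℕ => S ^ 2 * ε n) := fun a b hab =>
    mul_le_mul_of_nonneg_left (hεa hab) (sq_nonneg S)
  have hεs' : Summable (fun k : ℕ => S ^ 2 * ε (2 ^ k)) := hεs.mul_left (S ^ 2)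
  exact hglue D S (2 * Cp * S ^ 2) (1 / (2 * Cq)) (fun n => S ^ 2 * ε n) N₀ (by positivity)
    hfloor hDS hslowD hεa' hεs' h2D h3D

/-- **The line's composition with the proved glue**: the two physics stubs alone imply the crux (by name). -/
theorem boundedResponseConverges_of (hU : UpperIncrement) (hS : SelfSimilarGluing) :
    Summit.AtomisticToContinuum.FouriersLaw.Theses.OddSectorIrreversibility.BoundedResponseConverges :=
  boundedResponseConverges_of_glue TwoScaleGluingGlue.logScaleRigidity hU hS

end Composition

end Summit.AtomisticToContinuum.FouriersLaw.Cruxes.BoundedResponseConverges.TwoScaleGluing
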